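import Mathlib.MeasureTheory.Function.L2Space
import Mathlib.MeasureTheory.Integral.Bochner.ContinuousLinearMap
import Mathlib.MeasureTheory.Integral.Prod
import HarnessLib

/-!
# Factorisation of `∫∫ ḡ_L(x) g_R(y) ⟪V_L(x), A V_R(y)⟫` through superposed vectors

Analysis/InnerProduct support file (everything proved, no definitions). In a complex Hilbert space
`H`, for a bounded operator `A`, weights `g_L : X → ℂ`, `g_R : Y → ℂ` and vector fields
`V_L : X → H`, `V_R : Y → H` with `g_L • V_L`, `g_R • V_R` integrable,

  `∫_{X×Y} conj(g_L x) g_R y ⟪V_L x, A (V_R y)⟫ d(μ⊗ν) = ⟪∫ g_L • V_L dμ, A (∫ g_R • V_R dν)⟫`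

(`integral_prod_inner_eq_inner_integral_smul`). This is the step "the `i`-th slot of the
functional is a single matrix element `(Ψ₁, e^{-τH} Ψ₂)` of superposed vectors" in
Osterwalder–Schrader II (Comm. Math. Phys. 42 (1975)), Ch. V (5.4) and Ch. VI.1 (where the norms
of the superposed vectors `Ψ₁, Ψ₂` are then estimated), written at the level of Hilbert spaces.

## References

* K. Osterwalder, R. Schrader, *Axioms for Euclidean Green's functions II*, Comm. Math. Phys.
  42 (1975) 281–305, Ch. V (5.4), Ch. VI.1. [OsterwalderSchraderCMP1975]
-/

noncomputable section

open MeasureTheory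
open scoped InnerProductSpace ComplexConjugate

namespace Literature.Analysis.InnerProduct

variable {H : Type*} [NormedAddCommGroup H] [InnerProductSpace ℂ H] [CompleteSpace H]
  {X Y : Type*} [MeasurableSpace X] [MeasurableSpace Y] {μ : Measure X} {ν : Measure Y}

/-- **Inner products with a superposed vector on the left**:
`⟪∫ g • V dμ, w⟫ = ∫ conj(g x) ⟪V x, w⟫ dμ`. [folklore] -/
theorem inner_integral_smul_left {g : X → ℂ} {V : X → H} (hint : Integrable (fun x => g x • V x) μ) (w : H) :
    ⟪∫ x, g x • V x ∂μ, w⟫_ℂ = ∫ x, conj (g x) * ⟪V x, w⟫_ℂ ∂μ := by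
  rw [← inner_conj_symm, ← integral_inner hint w, ← integral_conj]
  refine integral_congr_ae (Filter.Eventually.of_forall fun x => ?_)
  simp only [inner_smul_right, map_mul, inner_conj_symm]

/-- **Inner products with a superposed vector on the right**:
`⟪w, ∫ g • V dν⟫ = ∫ g y ⟪w, V y⟫ dν`. [folklore] -/
theorem inner_integral_smul_right {g : Y → ℂ} {V : Y → H} (hint : Integrable (fun y => g y • V y) ν) (w : H) :
    ⟪w, ∫ y, g y • V y ∂ν⟫_ℂ = ∫ y, g y * ⟪w, V y⟫_ℂ ∂ν := by
  rw [← integral_inner hint w]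
  refine integral_congr_ae (Filter.Eventually.of_forall fun y => ?_)
  simp only [inner_smul_right]

variable [SFinite ν] [SFinite μ]

/-- **Factorisation of the double integral of matrix elements**: for a bounded operator `A`,
`∫_{X×Y} conj(g_L x) g_R y ⟪V_L x, A (V_R y)⟫ = ⟪∫ g_L • V_L, A (∫ g_R • V_R)⟫`, provided
`g_L • V_L`, `g_R • V_R` are integrable and the fields are strongly measurable. [cite: OsterwalderSchraderCMP1975, Ch. V eq. (5.4)] -/
theorem integral_prod_inner_eq_inner_integral_smul (A : H →L[ℂ] H) {gL : X → ℂ} {VL : X → H} {gR : Y → ℂ} {VR : Y → H}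
    (hgL : AEStronglyMeasurable gL μ) (hVL : AEStronglyMeasurable VL μ)
    (hgR : AEStronglyMeasurable gR ν) (hVR : AEStronglyMeasurable VR ν)
    (hL : Integrable (fun x => ‖gL x‖ * ‖VL x‖) μ) (hR : Integrable (fun y => ‖gR y‖ * ‖VR y‖) ν) :
    ∫ z : X × Y, (conj (gL z.1) * gR z.2) * ⟪VL z.1, A (VR z.2)⟫_ℂ ∂(μ.prod ν) =
      ⟪∫ x, gL x • VL x ∂μ, A (∫ y, gR y • VR y ∂ν)⟫_ℂ := by
  -- integrability of the vector-valued integrands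
  have hLi : Integrable (fun x => gL x • VL x) μ :=
    hL.mono' (hgL.smul hVL) (Filter.Eventually.of_forall fun x => by rw [norm_smul])
  have hRi : Integrable (fun y => gR y • VR y) ν :=
    hR.mono' (hgR.smul hVR) (Filter.Eventually.of_forall fun y => by rw [norm_smul])
  -- integrability of the scalar integrand on the product
  have h1 : AEStronglyMeasurable (fun z : X × Y => conj (gL z.1)) (μ.prod ν) :=
    Complex.continuous_conj.comp_aestronglyMeasurable hgL.comp_fst
  have h2 : AEStronglyMeasurable (fun z : X × Y => gR z.2) (μ.prod ν) := hgR.comp_snd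
  have h3 : AEStronglyMeasurable (fun z : X × Y => ⟪VL z.1, A (VR z.2)⟫_ℂ) (μ.prod ν) :=
    hVL.comp_fst.inner (A.continuous.comp_aestronglyMeasurable hVR.comp_snd)
  have hFm : AEStronglyMeasurable (fun z : X × Y => (conj (gL z.1) * gR z.2) * ⟪VL z.1, A (VR z.2)⟫_ℂ) (μ.prod ν) :=
    (h1.mul h2).mul h3
  have hFi : Integrable (fun z : X × Y => (conj (gL z.1) * gR z.2) * ⟪VL z.1, A (VR z.2)⟫_ℂ) (μ.prod ν) := by
    refine ((hL.mul_prod hR).const_mul ‖A‖).mono' hFm (Filter.Eventually.of_forall fun z => ?_)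
    simp only [norm_mul, Complex.norm_conj]
    calc ‖gL z.1‖ * ‖gR z.2‖ * ‖⟪VL z.1, A (VR z.2)⟫_ℂ‖
        ≤ ‖gL z.1‖ * ‖gR z.2‖ * (‖VL z.1‖ * (‖A‖ * ‖VR z.2‖)) := by
          gcongr
          exact (norm_inner_le_norm _ _).trans (mul_le_mul_of_nonneg_left (A.le_opNorm _) (norm_nonneg _))
      _ = ‖A‖ * (‖gL z.1‖ * ‖VL z.1‖ * (‖gR z.2‖ * ‖VR z.2‖)) := by ring
  -- compute the right-hand side
  have hARi : Integrable (fun y => gR y • A (VR y)) ν := by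
    have h := A.integrable_comp hRi
    refine h.congr (Filter.Eventually.of_forall fun y => ?_)
    simp only [map_smul]
  rw [← A.integral_comp_comm hRi]
  simp_rw [map_smul]
  rw [inner_integral_smul_right hARi]
  simp_rw [inner_integral_smul_left hLi]
  -- Fubini
  rw [integral_prod_symm _ hFi]
  refine integral_congr_ae (Filter.Eventually.of_forall fun y => ?_)
  beta_reduce
  rw [← integral_const_mul]
  refine integral_congr_ae (Filter.Eventually.of_forall fun x => ?_)
  beta_reduce
  ring

end Literature.Analysis.InnerProduct
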